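import Mathlib.Data.Int.Order.Units
import Mathlib.NumberTheory.Padics.ProperSpace
import Mathlib.GroupTheory.OrderOfElement
import Mathlib.Topology.Algebra.Ring.Basic
import Mathlib.Topology.Algebra.Group.Basic
import HarnessLib

/-!
# The infinite dihedral group `D_∞ = ℤ ⋊ {±1}` inside `ℤ₂ ⋊ {±1}`: carrier of a model of [IUTchI] §2

Mochizuki, *Inter-universal Teichmüller theory I: construction of Hodge theaters*, kurims manuscript
(May 2020), §2, Proposition 2.1 p. 45, Proposition 2.4 p. 50 [cite: Mochizuki2012, Prop 2.1 p.45; Prop 2.4 p.50]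
(D-0012 claim key; series status DISPUTED; nothing of the series is asserted here — this file contains NO
statement of the paper).

ELEMENTARY CARRIER FILE (abc-iut cell, block F, seat abc-iut-f-193; FACT-LIST rows F-2599 / F-2600 / F-2601,
[IUTchI] Prop. 2.4 (i)–(iii)) for the model `TemperedCoveringsDihedralModel.lean`: the affine group
`Dih R = R ⋊ {±1}` of a commutative ring `R` (pairs `(t, e)`, `e = ±1`, `(t,e)(t',e') = (t + e t', e e')`)
with the product topology; for `R = ℤ` this is the infinite dihedral group `D_∞` (discrete), for `R = ℤ₂`
the compact group `ℤ₂ ⋊ {±1}` (the pro-2 completion of `D_∞`), and `iota : D_∞ ↪ ℤ₂ ⋊ {±1}` is the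
inclusion.  Proved here [folklore]: the group / topological-group structure, compactness and discreteness,
the conjugation formulae (`conj_eq`: `γ (a, δ) γ⁻¹ = ((1 − δ) b + ε a, δ)` for `γ = (b, ε)`), the **2-adic
purity** of `ℤ ⊂ ℤ₂` (`exists_eq_intCast_of_two_mul`: `2b ∈ ℤ ⇒ b ∈ ℤ`), its consequence
`mem_range_of_conj_reflection_mem` (an element of `ℤ₂ ⋊ {±1}` conjugating a REFLECTION of `D_∞` into `D_∞`
lies in `D_∞`), and `exists_reflection_of_finite` (a nontrivial finite subgroup of `D_∞` contains a
reflection).  All [folklore]; no definition of the paper; nothing here bears on [IUTchIII] Cor. 3.12.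
-/

noncomputable section

namespace Literature.IUT.HodgeTheaters

namespace DihedralModel



/-- The group of affine maps `x ↦ e·x + t` of a commutative ring `R` with `e = ±1`:
pairs `(t, e)` with `(t, e)·(t', e') = (t + e t', e e')`.  For `R = ℤ` this is the infinite
dihedral group `D_∞ = ℤ ⋊ {±1}`. ([IUTchI] §2 model carrier, p.50) [claim: Mochizuki2012, status: disputed] -/
@[ext] structure Dih (R : Type*) where
  /-- translation part [folklore] -/
  t : R
  /-- sign [folklore] -/
  e : ℤˣ

namespace Dih

variable {R : Type*} [CommRing R]

/-- Multiplication `(t, e)·(t', e') = (t + e t', e e')`. [folklore] -/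
instance : Mul (Dih R) := ⟨fun x y => ⟨x.t + (x.e : ℤ) * y.t, x.e * y.e⟩⟩
/-- Unit `(0, 1)`. [folklore] -/
instance : One (Dih R) := ⟨⟨0, 1⟩⟩
/-- Inverse `(t, e)⁻¹ = (−e t, e)`. [folklore] -/
instance : Inv (Dih R) := ⟨fun x => ⟨-((x.e : ℤ) * x.t), x.e⟩⟩

/-- Unfolding of the unit. ([IUTchI] §2 model carrier, p.50) [claim: Mochizuki2012, status: disputed] -/
theorem one_def : (1 : Dih R) = ⟨0, 1⟩ := rfl
/-- Translation part of a product. ([IUTchI] §2 model carrier, p.50) [claim: Mochizuki2012, status: disputed] -/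
@[simp] theorem mul_t (x y : Dih R) : (x * y).t = x.t + (x.e : ℤ) * y.t := rfl
/-- Sign of a product. ([IUTchI] §2 model carrier, p.50) [claim: Mochizuki2012, status: disputed] -/
@[simp] theorem mul_e (x y : Dih R) : (x * y).e = x.e * y.e := rfl
/-- Translation part of the unit. ([IUTchI] §2 model carrier, p.50) [claim: Mochizuki2012, status: disputed] -/
@[simp] theorem one_t : (1 : Dih R).t = 0 := rfl
/-- Sign of the unit. ([IUTchI] §2 model carrier, p.50) [claim: Mochizuki2012, status: disputed] -/
@[simp] theorem one_e : (1 : Dih R).e = 1 := rfl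
/-- Translation part of an inverse. ([IUTchI] §2 model carrier, p.50) [claim: Mochizuki2012, status: disputed] -/
@[simp] theorem inv_t (x : Dih R) : x⁻¹.t = -((x.e : ℤ) * x.t) := rfl
/-- Sign of an inverse. ([IUTchI] §2 model carrier, p.50) [claim: Mochizuki2012, status: disputed] -/
@[simp] theorem inv_e (x : Dih R) : x⁻¹.e = x.e := rfl

/-- `(e : R)·(e : R) = 1` for a unit `e` of `ℤ`.
([IUTchI] §2 model carrier, p.50) [claim: Mochizuki2012, status: disputed] -/
@[simp] theorem units_cast_mul_self (e : ℤˣ) : ((e : ℤ) : R) * ((e : ℤ) : R) = 1 := by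
  rw [← Int.cast_mul, ← Units.val_mul, Int.units_mul_self, Units.val_one, Int.cast_one]

/-- `Dih R` is a group (the semidirect product `R ⋊ {±1}`). [folklore] -/
instance : Group (Dih R) where
  mul_assoc x y z := by
    ext
    · simp only [mul_t, mul_e, Units.val_mul, Int.cast_mul]; ring
    · simp only [mul_e, mul_assoc]
  one_mul x := by
    ext
    · simp only [mul_t, one_t, one_e, Units.val_one, Int.cast_one, one_mul, zero_add]
    · simp only [mul_e, one_e, one_mul]
  mul_one x := by
    ext
    · simp only [mul_t, one_t, mul_zero, add_zero]
    · simp only [mul_e, one_e, mul_one]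
  inv_mul_cancel x := by
    ext
    · simp only [mul_t, inv_t, inv_e, one_t, neg_add_cancel]
    · simp only [mul_e, inv_e, Int.units_mul_self, one_e]

/-- The sign homomorphism `(t, e) ↦ e`. [folklore] -/
def sgn : Dih R →* ℤˣ where
  toFun := Dih.e
  map_one' := rfl
  map_mul' _ _ := rfl

/-- The sign homomorphism is the projection `e`.
([IUTchI] §2 model carrier, p.50) [claim: Mochizuki2012, status: disputed] -/
@[simp] theorem sgn_apply (x : Dih R) : sgn x = x.e := rfl

/-- Conjugation formula: `γ x γ⁻¹ = ((1 - x.e)·γ.t + γ.e·x.t, x.e)`.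
([IUTchI] §2 model carrier, p.50) [claim: Mochizuki2012, status: disputed] -/
theorem conj_eq (γ x : Dih R) :
    γ * x * γ⁻¹ = ⟨γ.t + (γ.e : ℤ) * x.t - (x.e : ℤ) * γ.t, x.e⟩ := by
  ext
  · simp only [mul_t, mul_e, inv_t, Units.val_mul, Int.cast_mul]
    have h := units_cast_mul_self (R := R) γ.e
    linear_combination (-(↑↑x.e * γ.t)) * h
  · simp only [mul_e, inv_e]
    rw [mul_comm γ.e x.e, mul_assoc, Int.units_mul_self, mul_one]

/-- Conjugate of a reflection `(a, -1)`: `γ (a,-1) γ⁻¹ = (2 γ.t + γ.e a, -1)`.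
([IUTchI] §2 model carrier, p.50) [claim: Mochizuki2012, status: disputed] -/
theorem conj_reflection_t (γ x : Dih R) (hx : x.e = -1) :
    (γ * x * γ⁻¹).t = 2 * γ.t + (γ.e : ℤ) * x.t := by
  rw [conj_eq]
  simp only [hx, Units.val_neg, Units.val_one, Int.cast_neg, Int.cast_one]
  ring

/-- Conjugate of a translation `(a, 1)`: `γ (a,1) γ⁻¹ = (γ.e a, 1)`.
([IUTchI] §2 model carrier, p.50) [claim: Mochizuki2012, status: disputed] -/
theorem conj_translation (γ x : Dih R) (hx : x.e = 1) :
    γ * x * γ⁻¹ = ⟨(γ.e : ℤ) * x.t, 1⟩ := by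
  rw [conj_eq]
  ext
  · simp only [hx, Units.val_one, Int.cast_one]; ring
  · simp [hx]

/-- Powers of a translation: `(a, 1)^n = (n a, 1)`.
([IUTchI] §2 model carrier, p.50) [claim: Mochizuki2012, status: disputed] -/
theorem translation_pow (a : R) (n : ℕ) : (⟨a, 1⟩ : Dih R) ^ n = ⟨(n : R) * a, 1⟩ := by
  induction n with
  | zero => rw [pow_zero, one_def]; ext <;> simp
  | succ n ih =>
    rw [pow_succ, ih]
    ext
    · simp only [mul_t, Units.val_one, Int.cast_one, one_mul, Nat.cast_succ]; ring
    · simp only [mul_e, mul_one]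

/-- Change of coefficients along a ring homomorphism. [folklore] -/
def map {S : Type*} [CommRing S] (f : R →+* S) : Dih R →* Dih S where
  toFun x := ⟨f x.t, x.e⟩
  map_one' := by ext <;> simp
  map_mul' x y := by
    ext
    · simp only [mul_t, map_add, map_mul, map_intCast]
    · simp only [mul_e]

/-- `map f` acts by `f` on the translation part.
([IUTchI] §2 model carrier, p.50) [claim: Mochizuki2012, status: disputed] -/
@[simp] theorem map_apply_t {S : Type*} [CommRing S] (f : R →+* S) (x : Dih R) : (map f x).t = f x.t := rfl
/-- `map f` preserves the sign. ([IUTchI] §2 model carrier, p.50) [claim: Mochizuki2012, status: disputed] -/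
@[simp] theorem map_apply_e {S : Type*} [CommRing S] (f : R →+* S) (x : Dih R) : (map f x).e = x.e := rfl

/-- `map f` is injective when `f` is. ([IUTchI] §2 model carrier, p.50) [claim: Mochizuki2012, status: disputed] -/
theorem map_injective {S : Type*} [CommRing S] (f : R →+* S) (hf : Function.Injective f) :
    Function.Injective (map f) := by
  intro x y h
  have ht := congrArg Dih.t h
  have he := congrArg Dih.e h
  simp only [map_apply_t, map_apply_e] at ht he
  exact Dih.ext (hf ht) he

/-! ### Topology -/

end Dih

section ToProd

variable {R : Type*}

/-- The injection `Dih R → R × ℤ` used to define the topology (`ℤ` discrete). [folklore] -/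
def Dih.toProd (x : Dih R) : R × ℤ := (x.t, (x.e : ℤ))

/-- `toProd` is injective. ([IUTchI] §2 model carrier, p.50) [claim: Mochizuki2012, status: disputed] -/
theorem Dih.toProd_injective : Function.Injective (Dih.toProd (R := R)) := by
  intro x y h
  simp only [Dih.toProd, Prod.mk.injEq] at h
  exact Dih.ext h.1 (Units.ext h.2)

/-- The range of `toProd` is `R × {±1}`.
([IUTchI] §2 model carrier, p.50) [claim: Mochizuki2012, status: disputed] -/
theorem Dih.range_toProd : Set.range (Dih.toProd (R := R)) = Set.univ ×ˢ {1, -1} := by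
  ext ⟨r, n⟩
  simp only [Set.mem_range, Dih.toProd, Prod.mk.injEq, Set.mem_prod, Set.mem_univ, true_and,
    Set.mem_insert_iff, Set.mem_singleton_iff]
  constructor
  · rintro ⟨x, rfl, rfl⟩
    rcases Int.units_eq_one_or x.e with h | h <;> simp [h]
  · rintro (rfl | rfl)
    · exact ⟨⟨r, 1⟩, rfl, rfl⟩
    · exact ⟨⟨r, -1⟩, rfl, rfl⟩

variable [TopologicalSpace R]

/-- The topology of `Dih R`: induced from `R × ℤ` (`ℤ` discrete) along `toProd`, i.e. the product
topology on `R × {±1}`. [folklore] -/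
instance Dih.instTopologicalSpace : TopologicalSpace (Dih R) :=
  TopologicalSpace.induced Dih.toProd inferInstance

/-- `toProd` is a topological embedding (by definition of the topology).
([IUTchI] §2 model carrier, p.50) [claim: Mochizuki2012, status: disputed] -/
theorem Dih.isEmbedding_toProd : Topology.IsEmbedding (Dih.toProd (R := R)) :=
  ⟨⟨rfl⟩, Dih.toProd_injective⟩

/-- `toProd` is continuous. ([IUTchI] §2 model carrier, p.50) [claim: Mochizuki2012, status: disputed] -/
theorem Dih.continuous_toProd : Continuous (Dih.toProd (R := R)) := continuous_induced_dom

/-- The translation part is continuous.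
([IUTchI] §2 model carrier, p.50) [claim: Mochizuki2012, status: disputed] -/
theorem Dih.continuous_t : Continuous (Dih.t : Dih R → R) := continuous_fst.comp Dih.continuous_toProd

/-- The sign (valued in the discrete `ℤ`) is continuous.
([IUTchI] §2 model carrier, p.50) [claim: Mochizuki2012, status: disputed] -/
theorem Dih.continuous_e_val : Continuous (fun x : Dih R => (x.e : ℤ)) :=
  continuous_snd.comp Dih.continuous_toProd

/-- `Dih R` is compact when `R` is. ([IUTchI] §2 model carrier, p.50) [claim: Mochizuki2012, status: disputed] -/
theorem Dih.compactSpace_of_compactSpace [CompactSpace R] : CompactSpace (Dih R) := by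
  constructor
  rw [Dih.isEmbedding_toProd.isCompact_iff, Set.image_univ, Dih.range_toProd]
  exact isCompact_univ.prod (Set.toFinite _).isCompact

/-- `Dih R` is discrete when `R` is. ([IUTchI] §2 model carrier, p.50) [claim: Mochizuki2012, status: disputed] -/
theorem Dih.discreteTopology_of_discreteTopology [DiscreteTopology R] : DiscreteTopology (Dih R) :=
  Dih.isEmbedding_toProd.discreteTopology

end ToProd

namespace Dih

section Topology

variable {R : Type*} [CommRing R] [TopologicalSpace R]

/-- The sign cast into `R` is continuous.
([IUTchI] §2 model carrier, p.50) [claim: Mochizuki2012, status: disputed] -/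
theorem continuous_e_cast : Continuous (fun x : Dih R => ((x.e : ℤ) : R)) :=
  (continuous_of_discreteTopology (f := (Int.cast : ℤ → R))).comp continuous_e_val

/-- `map f` is continuous when `f` is. ([IUTchI] §2 model carrier, p.50) [claim: Mochizuki2012, status: disputed] -/
theorem continuous_map {S : Type*} [CommRing S] [TopologicalSpace S] (f : R →+* S)
    (hf : Continuous f) : Continuous (map f) := by
  refine continuous_induced_rng.2 (Continuous.prodMk ?_ ?_)
  · exact hf.comp continuous_t
  · exact continuous_e_val

variable [IsTopologicalRing R]

/-- `Dih R` is a topological group when `R` is a topological ring. [folklore] -/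
instance instIsTopologicalGroup : IsTopologicalGroup (Dih R) where
  continuous_mul := by
    refine continuous_induced_rng.2 (Continuous.prodMk ?_ ?_)
    · change Continuous (fun p : Dih R × Dih R => p.1.t + ((p.1.e : ℤ) : R) * p.2.t)
      exact (continuous_t.comp continuous_fst).add
        ((continuous_e_cast.comp continuous_fst).mul (continuous_t.comp continuous_snd))
    · change Continuous (fun p : Dih R × Dih R => ((p.1.e * p.2.e : ℤˣ) : ℤ))
      simp only [Units.val_mul]
      exact (continuous_e_val.comp continuous_fst).mul (continuous_e_val.comp continuous_snd)
  continuous_inv := by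
    refine continuous_induced_rng.2 (Continuous.prodMk ?_ ?_)
    · change Continuous (fun x : Dih R => -(((x.e : ℤ) : R) * x.t))
      exact (continuous_e_cast.mul continuous_t).neg
    · exact continuous_e_val

end Topology

end Dih

/-! ### The inclusion `D_∞ = Dih ℤ ↪ Dih ℤ_[2]` and 2-adic purity -/

section TwoAdic

open Dih

/-- The inclusion `ι : D_∞ = ℤ ⋊ {±1} ↪ ℤ₂ ⋊ {±1}` (the pro-2 completion of `D_∞`). [folklore] -/
noncomputable def iota : Dih ℤ →* Dih ℤ_[2] := Dih.map (Int.castRingHom ℤ_[2])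

/-- `ι` casts the translation part. ([IUTchI] §2 model carrier, p.50) [claim: Mochizuki2012, status: disputed] -/
@[simp] theorem iota_t (x : Dih ℤ) : (iota x).t = (x.t : ℤ_[2]) := rfl
/-- `ι` preserves the sign. ([IUTchI] §2 model carrier, p.50) [claim: Mochizuki2012, status: disputed] -/
@[simp] theorem iota_e (x : Dih ℤ) : (iota x).e = x.e := rfl

/-- `ι : D_∞ → ℤ₂ ⋊ {±1}` is injective.
([IUTchI] §2 model carrier, p.50) [claim: Mochizuki2012, status: disputed] -/
theorem iota_injective : Function.Injective iota :=
  Dih.map_injective _ (RingHom.injective_int (Int.castRingHom ℤ_[2]))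

/-- `ι` is continuous (`D_∞` is discrete).
([IUTchI] §2 model carrier, p.50) [claim: Mochizuki2012, status: disputed] -/
theorem continuous_iota : Continuous iota :=
  Dih.continuous_map _ (continuous_of_discreteTopology)

/-- An element of `ℤ₂ ⋊ {±1}` lies in `D_∞` iff its translation part is a rational integer.
([IUTchI] §2 model carrier, p.50) [claim: Mochizuki2012, status: disputed] -/
theorem mem_range_iota_iff (y : Dih ℤ_[2]) : y ∈ iota.range ↔ ∃ n : ℤ, y.t = n := by
  constructor
  · rintro ⟨x, rfl⟩
    exact ⟨x.t, rfl⟩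
  · rintro ⟨n, hn⟩
    exact ⟨⟨n, y.e⟩, Dih.ext hn.symm rfl⟩

/-- **2-adic purity of `ℤ ⊂ ℤ₂`**: if `2b` is a rational integer then so is `b`.
([IUTchI] §2 model carrier, p.50) [claim: Mochizuki2012, status: disputed] -/
theorem exists_eq_intCast_of_two_mul (b : ℤ_[2]) (m : ℤ) (h : 2 * b = m) : ∃ n : ℤ, b = n := by
  by_cases hm : (2 : ℤ) ∣ m
  · obtain ⟨n, rfl⟩ := hm
    refine ⟨n, ?_⟩
    have h2 : (2 : ℤ_[2]) ≠ 0 := two_ne_zero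
    rw [Int.cast_mul, Int.cast_ofNat] at h
    exact mul_left_cancel₀ h2 h
  · exfalso
    have hnorm : ‖(m : ℤ_[2])‖ = 1 :=
      le_antisymm (PadicInt.norm_le_one _) (not_lt.mp (mt (PadicInt.norm_int_lt_one_iff_dvd m).mp hm))
    have h2 : ‖(2 : ℤ_[2])‖ < 1 := by
      have : ‖((2 : ℕ) : ℤ_[2])‖ = ((2 : ℕ) : ℝ)⁻¹ := PadicInt.norm_p
      rw [Nat.cast_ofNat] at this
      rw [this]; norm_num
    have : ‖(m : ℤ_[2])‖ < 1 := by
      rw [← h, norm_mul]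
      calc ‖(2 : ℤ_[2])‖ * ‖b‖ ≤ ‖(2 : ℤ_[2])‖ * 1 :=
            mul_le_mul_of_nonneg_left (PadicInt.norm_le_one b) (norm_nonneg _)
        _ < 1 := by rw [mul_one]; exact h2
    exact absurd hnorm (ne_of_lt this)

/-- **The content of Prop. 2.1 / 2.4 (i)(ii) at the dihedral datum**: an element `γ` of the completion
conjugating some REFLECTION of `D_∞` back into `D_∞` lies in `D_∞` (its translation part `b`
satisfies `2b ∈ ℤ`, hence `b ∈ ℤ` by 2-adic purity).
([IUTchI] §2 model carrier, p.50) [claim: Mochizuki2012, status: disputed] -/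
theorem mem_range_of_conj_reflection_mem (γ : Dih ℤ_[2]) (x : Dih ℤ) (hx : x.e = -1)
    (h : γ * iota x * γ⁻¹ ∈ iota.range) : γ ∈ iota.range := by
  rw [mem_range_iota_iff] at h ⊢
  obtain ⟨n, hn⟩ := h
  rw [Dih.conj_reflection_t γ (iota x) hx, iota_t] at hn
  have h2 : 2 * γ.t = ((n - (γ.e : ℤ) * x.t : ℤ) : ℤ_[2]) := by
    rw [Int.cast_sub, Int.cast_mul, ← hn]; ring
  exact exists_eq_intCast_of_two_mul γ.t _ h2

/-- A translation `(a, 1)` of `D_∞` with `a ≠ 0` has infinite order.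
([IUTchI] §2 model carrier, p.50) [claim: Mochizuki2012, status: disputed] -/
theorem not_isOfFinOrder_translation (x : Dih ℤ) (hx : x.e = 1) (ha : x.t ≠ 0) : ¬ IsOfFinOrder x := by
  intro hfin
  obtain ⟨n, hn, hpow⟩ := hfin.exists_pow_eq_one
  have hx' : x = ⟨x.t, 1⟩ := Dih.ext rfl hx
  rw [hx', Dih.translation_pow] at hpow
  have := congrArg Dih.t hpow
  simp only [Dih.one_t, mul_eq_zero, Int.natCast_eq_zero] at this
  rcases this with h | h
  · exact absurd h (Nat.pos_iff_ne_zero.mp hn)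
  · exact ha h

/-- A nontrivial element of `D_∞` of finite order is a reflection.
([IUTchI] §2 model carrier, p.50) [claim: Mochizuki2012, status: disputed] -/
theorem e_eq_neg_one_of_isOfFinOrder (x : Dih ℤ) (h1 : x ≠ 1) (hfin : IsOfFinOrder x) : x.e = -1 := by
  rcases Int.units_eq_one_or x.e with h | h
  · exfalso
    by_cases ha : x.t = 0
    · exact h1 (Dih.ext ha h)
    · exact not_isOfFinOrder_translation x h ha hfin
  · exact h

/-- A nontrivial FINITE subgroup of `D_∞` (equivalently: a nontrivial compact subgroup of the
discrete group `D_∞`) contains a reflection.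
([IUTchI] §2 model carrier, p.50) [claim: Mochizuki2012, status: disputed] -/
theorem exists_reflection_of_finite {Λ : Subgroup (Dih ℤ)} (hfin : (Λ : Set (Dih ℤ)).Finite)
    (hne : Λ ≠ ⊥) : ∃ x ∈ Λ, x.e = -1 := by
  obtain ⟨⟨x, hxΛ⟩, hx1⟩ := Subgroup.ne_bot_iff_exists_ne_one.mp hne
  have hx1' : x ≠ 1 := fun h => hx1 (Subtype.ext h)
  haveI : Finite Λ := hfin.to_subtype
  have hfo : IsOfFinOrder (⟨x, hxΛ⟩ : Λ) := isOfFinOrder_of_finite _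
  exact ⟨x, hxΛ, e_eq_neg_one_of_isOfFinOrder x hx1' (Λ.subtype.isOfFinOrder hfo)⟩

end TwoAdic


end DihedralModel

end Literature.IUT.HodgeTheaters

end
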